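import Summits.QuantumFields.BalabanUV.T4Continuum.Support.InsertionChannelReading
import Summits.QuantumFields.BalabanUV.T4Continuum.Support.NE9Lemma1Gain
import Summits.QuantumFields.BalabanUV.T4Continuum.Support.OutputRateCount124

/-!
# InsertionChannelEnd — the NE5-W3 × NE9-S5 junction (`InsertionChannelReading`) COMPLETED: (i) W3 for row NE9's GAIN-PARAMETRIC piece
# form (`NE9Lemma1Gain`: `PieceBoundG` + `LevelCountsG … gain (agePow ω)`, the shapes row NE9 proves on the carriers of record modulo its
# O1-side identification binders — `NE9LevelCountsRecordFive.levelCountsG_of_record₅_agePow`); (ii) the DAMPED INSERTION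
# `StepModel.InsertionDampedNat W κ c ω` of a channel-reading step model WITHOUT ANY HOMOGENEITY BINDER (the channel gives
# `InsScaleBoundLevel` at EVERY level, so `sizeDampedNat_of_scaleBoundLevel` applies and `InsHomog` ∕ `ChannelHomog` drop out); (iii) the
# END face C1 of route P1 (row NE5, node U3) APPLIED with W3 and the structure binders READ FROM a localization channel of row NE9 —
# for NE9-P2's evaluation channels and the gain-parametric piece form at a general profile `(c, ω)`
# (`T4InputCauchyRateData.StepModel.ne5_at_of_stepModel_lip_nat` with `dataLipschitz_of_fibreEnvelopes`, BY NAME), and for the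
# ℓ⁵-piece form of [II] (1.23)∕(1.33) at the printed-count letters `c = (6L)⁴`, `ω = L⁻¹` (the owner's
# `OutputRateCount124.ne5_at_of_stepModel_lip_count124_nat` BY NAME, smallness in the `G`-form `G < (θ′ − L⁻¹)(1 − ρ₀)∕(6L)⁴`)
# (cell `pub-balaban`, T⁴ fan-out; row O1-c HISTORY ∕ TABLES holder applying landed END faces BY NAME in a NEW module — not a re-wiring
# of `OutputRate*`; owner RULING R30 «to be FED by leaf-06-g2's `InsertionChannelReading`»; journal INTENT l.12531, owner g32 l.12675)

Unit `b2b-balaban-t4-ne5-formalise-leaf-06` (NE5 formalisation swarm, leaf prover 06, gen 2).  Summits-side NEW WORK under the LEAN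
PLACEMENT RULE (bookkeeping; nothing of the manuscripts under audit is asserted; 0 cite tags).  HONEST FRAMING: rung (B)+1 of the
FINITE-VOLUME T⁴ continuum programme — NOT infinite volume, NOT a mass gap, NOT the Clay problem, NOT a proof of NE5 (`T4OutputRate.NE5`,
NOT PRINTED; cell GAPS G-t4-U3-1) nor of NE9; spine 0/9 unchanged.  HONEST DEPENDENCY (cell line, verbatim): continuum YM on T⁴ ⇐
BetaPertH ∧ nine spine estimates (0/9 proved); BetaPertH ⇐ (D1) ∧ (D4) ∧ CAP+tail; G-an2-4 gates asym, D1 and NE2/3/4.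

WHAT THIS FILE TYPES (all conclusions the tree's shapes BY NAME; the END faces conclude LITERALLY `T4OutputRate.NE5 EA EB W κ θ′ C₅`
with the parent face's constant read at `Λ := G∕(1 − ρ₀)` — the same expression as E1′'s — every other binder VERBATIM):
* §1 W3, GAIN-PARAMETRIC: `insScaleBoundLevel_of_readsPieceChannelG : … → M.InsScaleBoundLevel W κ cQ ω` (+ `insScaleBound_…G`) from
  `SrcScale`, the general-gain (1.24)×(1.25)-SHAPE `PieceBoundG P κ κ₁ d0 Kp gain` ([I] (0.29)∕(4.18) gains; DISPLAYED in row NE9 —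
  proof-interior of [I] §§3–5, NOT printed as a statement, NOT proved), `LevelCountsG P κ κ₁ O1 cQ gain (agePow ω)` ((1.26)–(1.28) p. 8,
  □′-count against the gain — here a hypothesis), `0 ≤ Kp, O1, gain, cQ, ω` and the weight dictionary for `weightOf`, via
  `NE9Lemma1Gain.channelSizeAtStepNN_pieceG_profile` BY NAME.
* §2 THE DAMPED INSERTION WITHOUT HOMOGENEITY: `insertionDampedNat_of_readsChannel : … → M.InsertionDampedNat W κ c ω` from the reading,
  admissible constants, `ChannelAdditive`, `ChannelLocal`, `ChannelSizeAtStepNN` + profile + weight dictionary — through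
  `InsertionChannelReading` §§3–4 and `StepModel.sizeDampedNat_of_scaleBoundLevel` ∕ `insertionDampedNat_of_affine` (NO `InsHomog`: the
  channel's size binder gives EVERY level); specialisations `insertionDampedNat_of_readsEvalChannel` (kernel mass),
  `insertionDampedNat_of_readsPieceChannelG` (`cQ`, `ω`), `insertionDampedNat_of_readsPieceChannel` (`(6L)⁴`, `L⁻¹`) — for the piece forms
  `ChannelAdditive`∕`ChannelLocal` hold on any class, so NO structure binder of the channel remains displayed.
* §3 END faces (C1 = `ne5_at_of_stepModel_lip_nat` with `hlip := dataLipschitz_of_fibreEnvelopes hopF hhistF hρ₀`, `Λ = G∕(1 − ρ₀)`;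
  `hdamp` from §2): `ne5_at_of_stepModel_fibre_evalChannel_nat` (general `c`, `ω`), `ne5_at_of_stepModel_fibre_pieceChannelG_nat`
  (general `cQ`, `ω`), and `ne5_at_of_stepModel_fibre_pieceChannel_nat` (the owner's `…_lip_count124_nat` at `c = (6L)⁴`, `ω = L⁻¹`,
  the `G`-form smallness converted by `smallnessG_count124_iff` ∕ `smallness_count124_iff`) — in each, the parent's insertion binders
  (`hdamp`, resp. E1′'s `haff`∕`hblind`∕`hhom`∕`hunit`) are REPLACED by the reading + NE9's displayed binders; NO homogeneity, NO
  reference level `E₁`.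
UNITS (owner R30 (i)): `(c, ω)`, `G`, `ρ₀` are in the margin units `M.rHist` fixed by the weight dictionary (see `InsertionChannelReading`'s
header).  STATUS (census, Edison rule): bookkeeping + END faces BY NAME; discharge NO estimate of [II]; for channel-reading insertions
leaf L09 (W3) AND the insertion structure binders of row NE5 are READ FROM row NE9's displayed `PieceBound(G)` ∕ `LevelCounts(G)` ∕
kernel mass + the reading (NOT «W3 proved»); the remaining analytic binders (W2 = the two fibre envelopes, W1 = `OperatorRate`,
W4 = `InsertionRate`, L05∕L06, L03 = `InBase`, MI-R) stay DISPLAYED exactly as in the parent faces; `ReadsChannel` is MODEL LEVEL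
(an MI-R-class identification, owner R8∕R30).  NE5 NOT PROVED; NE9 NOT PROVED; 0/12 leaves on Bałaban's concrete objects; spine 0/9;
rung (B)+1 finite T⁴; NOT infinite volume ∕ mass gap ∕ Clay.  0 sorry; axioms ⊆ {propext, Classical.choice, Quot.sound}.
-/

noncomputable section

open MeasureTheory

namespace Summit.QuantumFields.BalabanUV.T4Continuum.InsertionChannelEnd

open Literature.MathematicalPhysics.QuantumFieldTheory.Balaban1983to89
open Literature.MathematicalPhysics.QuantumFieldTheory.Balaban1983to89.T4OutputRate (Carriers Functional DecayBound NE5)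
open Literature.MathematicalPhysics.QuantumFieldTheory.Balaban1983to89.T4InputCauchyRateData (StepModel)
open Literature.MathematicalPhysics.QuantumFieldTheory.Balaban1983to89.T4HistoryLipschitzRecursion
  (ChannelAdditive ChannelLocal ChannelSizeAtStepNN)
open Summit.QuantumFields.BalabanUV.T4Continuum.B13HistDatum (HistFrame Hist)
open Summit.QuantumFields.BalabanUV.T4Continuum.NE9EvaluationChannel (evalChannel channelAdditive_eval channelLocal_eval
  channelSizeAtStepNN_of_kernelMass)
open Summit.QuantumFields.BalabanUV.T4Continuum.NE9Lemma1Counting (PieceData pieceChannel SrcScale PieceBound LevelCounts weightOf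
  ellPrinted channelAdditive_piece channelLocal_piece channelSizeAtStepNN_piece_printed)
open Summit.QuantumFields.BalabanUV.T4Continuum.NE9Lemma1Gain (PieceBoundG LevelCountsG agePow channelSizeAtStepNN_pieceG_profile)
open Summit.QuantumFields.BalabanUV.T4Continuum.OutputRateCount124 (smallness_count124_iff smallnessG_count124_iff)
open Summit.QuantumFields.BalabanUV.T4Continuum.InsertionChannelReading

variable {C : Carriers} {Bg ι : Type} {Op : Type*} [NormedAddCommGroup Op] [NormedSpace ℂ Op] {F : HistFrame C}
  {M : StepModel C Op (Hist F)} {out : F.Idx → ι} {W : Set (ℕ → ℝ)}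

/-! ## §1 W3 for a step model reading the GAIN-PARAMETRIC piece form (row NE9's kernel objects of record) -/

section PieceG

variable {α β γ : Type} {P : PieceData C Bg ι α β γ}

/-- [folklore] **W3 AT AN ARBITRARY LEVEL, GAIN-PARAMETRIC**: `M.InsScaleBoundLevel W κ cQ ω` for a step model whose insertion READS
the piece channel, from `SrcScale`, the general-gain (1.24)×(1.25)-SHAPE `PieceBoundG` (row NE9's displayed binder), the level counts
`LevelCountsG P κ κ₁ O1 cQ gain (agePow ω)` (□′-count against the gain, `card(□′)·gain k j ≤ cQ·ω^{k−j}` — the shape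
`levelCountsG_of_record₅_agePow` discharges on the carriers of record modulo identification binders), the signs and the weight
dictionary — `channelSizeAtStepNN_pieceG_profile` BY NAME.  Print's letters: `gain = (Lʲη)^{4+α}`, `cQ = (6L)⁴`, `ω = L^{−α}` ([I]
(0.29)–(0.30) p. 258); UNITS as in `InsertionChannelReading` (owner R30 (i)). -/
theorem insScaleBoundLevel_of_readsPieceChannelG {κ κ₁ d0 O1 cQ ω : ℝ} {Kp : ℕ → ι → ℝ} {gain : ℕ → ℕ → ℝ}
    (hR : ReadsChannel M (pieceChannel P) out W) (hsrc : SrcScale P) (hPiece : PieceBoundG P κ κ₁ d0 Kp gain)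
    (hLev : LevelCountsG P κ κ₁ O1 cQ gain (agePow ω)) (hKp : ∀ k y, 0 ≤ Kp k y) (hO1 : 0 ≤ O1) (hgain : ∀ k j, 0 ≤ gain k j)
    (hcQ : 0 ≤ cQ) (hω : 0 ≤ ω) (hwt : ∀ k i, weightOf P κ₁ d0 O1 Kp k (out i) ≤ M.rHist (k + 1) * F.wt i) :
    M.InsScaleBoundLevel W κ cQ ω := by
  obtain ⟨hsize, hprof, -, -⟩ :=
    channelSizeAtStepNN_pieceG_profile hsrc hPiece hLev hKp hO1 hgain hcQ hω (Set.univ : Set (Bg → C.Dom → ℝ))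
  exact insScaleBoundLevel_of_readsChannel hR (fun _ => Set.mem_univ _) hsize (fun k i => weightOf_nonneg hKp hO1 k (out i)) hwt
    hprof hcQ hω

/-- [folklore] **W3 AT THE REFERENCE LEVEL `E₁ ≥ 0`, GAIN-PARAMETRIC** (`StepModel.InsScaleBound`, cell gap G-ne5p1-3a″, BY NAME). -/
theorem insScaleBound_of_readsPieceChannelG {κ κ₁ d0 O1 cQ ω E₁ : ℝ} {Kp : ℕ → ι → ℝ} {gain : ℕ → ℕ → ℝ}
    (hR : ReadsChannel M (pieceChannel P) out W) (hsrc : SrcScale P) (hPiece : PieceBoundG P κ κ₁ d0 Kp gain)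
    (hLev : LevelCountsG P κ κ₁ O1 cQ gain (agePow ω)) (hKp : ∀ k y, 0 ≤ Kp k y) (hO1 : 0 ≤ O1) (hgain : ∀ k j, 0 ≤ gain k j)
    (hcQ : 0 ≤ cQ) (hω : 0 ≤ ω) (hwt : ∀ k i, weightOf P κ₁ d0 O1 Kp k (out i) ≤ M.rHist (k + 1) * F.wt i) (hE₁ : 0 ≤ E₁) :
    M.InsScaleBound W κ E₁ cQ ω := fun k g hg U t j hj hsupp hbd =>
  insScaleBoundLevel_of_readsPieceChannelG hR hsrc hPiece hLev hKp hO1 hgain hcQ hω hwt k g hg U t j E₁ hj hE₁ hsupp hbd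

end PieceG

/-! ## §2 The damped insertion of a channel-reading step model — no homogeneity binder -/

section Damped

variable {T : ℕ → (ℕ → ℝ) → (Bg → C.Dom → ℝ) → ι → ℝ} {Adm : Set (Bg → C.Dom → ℝ)}

/-- [folklore] **`InsertionDampedNat` FROM THE CHANNEL, WITHOUT HOMOGENEITY**: the near-regime recursion's insertion binder
`M.InsertionDampedNat W κ c ω` from the reading, admissible constant families, `ChannelAdditive` (⟹ `InsAffine`), `ChannelLocal`
(⟹ `InsBlind`), `ChannelSizeAtStepNN` + profile + weight dictionary (⟹ `InsScaleBoundLevel` at EVERY level) — assembled by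
`StepModel.sizeDampedNat_of_scaleBoundLevel` and `insertionDampedNat_of_affine`; `InsHomog` is not needed. -/
theorem insertionDampedNat_of_readsChannel {κ c ω : ℝ} {wt : ℕ → ι → ℝ} {τ : ℕ → ℕ → ℝ} (hR : ReadsChannel M T out W)
    (hadm : ∀ t : C.Dom → ℝ, constFam (Bg := Bg) t ∈ Adm) (hadd : ChannelAdditive Adm T) (hloc : ChannelLocal Adm T)
    (hsize : ChannelSizeAtStepNN Adm T κ wt τ) (hwt0 : ∀ k i, 0 ≤ wt k (out i))
    (hwt : ∀ k i, wt k (out i) ≤ M.rHist (k + 1) * F.wt i) (hτ : ∀ k j, j ≤ k → τ k j ≤ c * ω ^ (k - j)) (hc : 0 ≤ c)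
    (hω : 0 ≤ ω) : M.InsertionDampedNat W κ c ω :=
  have haff : M.InsAffine W := insAffine_of_readsChannel hR hadd hadm
  M.insertionDampedNat_of_affine haff (M.sizeDampedNat_of_scaleBoundLevel haff (insBlind_of_readsChannel hR hloc hadm)
    (insScaleBoundLevel_of_readsChannel hR hadm hsize hwt0 hwt hτ hc hω))

end Damped

section DampedEval

variable {Ω : Type*} [MeasurableSpace Ω] {F₀ : ℕ → (ℕ → ℝ) → ι → Finset C.Dom} {ν : ℕ → (ℕ → ℝ) → ι → C.Dom → Measure Ω}
  {w : ℕ → (ℕ → ℝ) → ι → C.Dom → Ω → ℝ} {bg : ℕ → (ℕ → ℝ) → ι → C.Dom → Ω → Bg}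

/-- [folklore] **`InsertionDampedNat` FOR A STEP MODEL READING AN EVALUATION CHANNEL** from the reading, integrable weights, source
locality, THE KERNEL-MASS INEQUALITY (NE9-P2's displayed binder), the profile and the weight dictionary. -/
theorem insertionDampedNat_of_readsEvalChannel {κ c ω : ℝ} {wt : ℕ → ι → ℝ} {τ : ℕ → ℕ → ℝ}
    (hR : ReadsChannel M (evalChannel F₀ ν w bg) out W)
    (hw : ∀ k s y, ∀ X ∈ F₀ k s y, Integrable (w k s y X) (ν k s y X)) (hF : ∀ k s y, ∀ X ∈ F₀ k s y, C.scale X ≤ k)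
    (hmass : ∀ (k j : ℕ) (s : ℕ → ℝ) (y : ι),
      ∑ X ∈ (F₀ k s y).filter (fun X => C.scale X = j), Real.exp (-(κ * C.d X)) * ∫ ω', |w k s y X ω'| ∂(ν k s y X) ≤
        wt k y * τ k j)
    (hwt0 : ∀ k i, 0 ≤ wt k (out i)) (hwt : ∀ k i, wt k (out i) ≤ M.rHist (k + 1) * F.wt i)
    (hτ : ∀ k j, j ≤ k → τ k j ≤ c * ω ^ (k - j)) (hc : 0 ≤ c) (hω : 0 ≤ ω) : M.InsertionDampedNat W κ c ω :=
  insertionDampedNat_of_readsChannel hR (constFam_mem_evalAdm hw) channelAdditive_eval (channelLocal_eval hF)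
    (channelSizeAtStepNN_of_kernelMass hw hmass) hwt0 hwt hτ hc hω

end DampedEval

section DampedPiece

variable {α β γ : Type} {P : PieceData C Bg ι α β γ}

/-- [folklore] **`InsertionDampedNat W κ cQ ω` FOR A STEP MODEL READING THE GAIN-PARAMETRIC PIECE FORM** — from the reading, `SrcScale`,
`PieceBoundG`, `LevelCountsG … (agePow ω)`, the signs and the weight dictionary; `ChannelAdditive`∕`ChannelLocal` hold for the piece form
on any class (`Adm := univ`), so NO structure binder of the channel and NO homogeneity remain displayed. -/
theorem insertionDampedNat_of_readsPieceChannelG {κ κ₁ d0 O1 cQ ω : ℝ} {Kp : ℕ → ι → ℝ} {gain : ℕ → ℕ → ℝ}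
    (hR : ReadsChannel M (pieceChannel P) out W) (hsrc : SrcScale P) (hPiece : PieceBoundG P κ κ₁ d0 Kp gain)
    (hLev : LevelCountsG P κ κ₁ O1 cQ gain (agePow ω)) (hKp : ∀ k y, 0 ≤ Kp k y) (hO1 : 0 ≤ O1) (hgain : ∀ k j, 0 ≤ gain k j)
    (hcQ : 0 ≤ cQ) (hω : 0 ≤ ω) (hwt : ∀ k i, weightOf P κ₁ d0 O1 Kp k (out i) ≤ M.rHist (k + 1) * F.wt i) :
    M.InsertionDampedNat W κ cQ ω := by
  obtain ⟨hsize, hprof, -, -⟩ :=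
    channelSizeAtStepNN_pieceG_profile hsrc hPiece hLev hKp hO1 hgain hcQ hω (Set.univ : Set (Bg → C.Dom → ℝ))
  exact insertionDampedNat_of_readsChannel hR (fun _ => Set.mem_univ _) (channelAdditive_piece P _) (channelLocal_piece hsrc _) hsize
    (fun k i => weightOf_nonneg hKp hO1 k (out i)) hwt hprof hcQ hω

/-- [folklore] **`InsertionDampedNat W κ ((6L)⁴) L⁻¹` FOR A STEP MODEL READING THE ℓ⁵-PIECE FORM** (print's letters, [II] p. 8 l. 9–10
*"This yields (6L)⁴Lʲη"*) — the `hdamp` binder of `OutputRateCount124.ne5_at_of_stepModel_lip_count124_nat` — from the reading,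
`SrcScale`, `PieceBound P κ κ₁ d0 Kp (ellPrinted L)`, `LevelCounts P κ κ₁ O1 L (ellPrinted L)`, `0 ≤ Kp`, `0 ≤ O1`, `1 < L` and the weight
dictionary; no homogeneity. -/
theorem insertionDampedNat_of_readsPieceChannel {κ κ₁ d0 O1 L : ℝ} {Kp : ℕ → ι → ℝ}
    (hR : ReadsChannel M (pieceChannel P) out W) (hsrc : SrcScale P) (hL1 : 1 < L)
    (hPiece : PieceBound P κ κ₁ d0 Kp (ellPrinted L)) (hLev : LevelCounts P κ κ₁ O1 L (ellPrinted L))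
    (hKp : ∀ k y, 0 ≤ Kp k y) (hO1 : 0 ≤ O1) (hwt : ∀ k i, weightOf P κ₁ d0 O1 Kp k (out i) ≤ M.rHist (k + 1) * F.wt i) :
    M.InsertionDampedNat W κ ((6 * L) ^ 4) L⁻¹ := by
  obtain ⟨hsize, hprof, hω, _⟩ := channelSizeAtStepNN_piece_printed hL1 hsrc hPiece hLev hKp hO1 (Set.univ : Set (Bg → C.Dom → ℝ))
  exact insertionDampedNat_of_readsChannel hR (fun _ => Set.mem_univ _) (channelAdditive_piece P _) (channelLocal_piece hsrc _) hsize
    (fun k i => weightOf_nonneg hKp hO1 k (out i)) hwt hprof (by positivity) hω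

end DampedPiece

/-! ## §3 The END face C1 applied: NE5 for channel-reading step models, W3 and structure read from the channel -/

section EndEval

variable {Ω : Type*} [MeasurableSpace Ω] {F₀ : ℕ → (ℕ → ℝ) → ι → Finset C.Dom} {ν : ℕ → (ℕ → ℝ) → ι → C.Dom → Measure Ω}
  {w : ℕ → (ℕ → ℝ) → ι → C.Dom → Ω → ℝ} {bg : ℕ → (ℕ → ℝ) → ι → C.Dom → Ω → Bg}

/-- [folklore] **NE5 FOR A STEP MODEL READING AN EVALUATION CHANNEL** (general profile `c`, `ω > 0`): C1
`StepModel.ne5_at_of_stepModel_lip_nat` with W2 supplied as the two FIBRE envelopes (`dataLipschitz_of_fibreEnvelopes`, `Λ = G∕(1 − ρ₀)`)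
and `hdamp` DISCHARGED by `insertionDampedNat_of_readsEvalChannel` — the reading, integrable weights, source locality, THE KERNEL-MASS
INEQUALITY, the profile and the weight dictionary replace every insertion structure∕size binder; the conclusion is E1′'s constant. -/
theorem ne5_at_of_stepModel_fibre_evalChannel_nat {EA : Functional C C.BgA} {EB : Functional C C.BgB}
    {κ G EA₀ E₀ δ δ' θ θ' c ω ρ₀ B : ℝ} {k₀ : ℕ} {wt : ℕ → ι → ℝ} {τ : ℕ → ℕ → ℝ}
    (hrA : M.RepresentsA EA W) (hrB : M.RepresentsB EB W) (hbase : M.InBase EB W) (hopF : M.OpFibreEnvelope W κ G)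
    (hhistF : M.HistFibreEnvelope W κ G) (hdA : DecayBound EA W EA₀ κ) (hdB : DecayBound EB W E₀ κ) (hop : M.OperatorRate W δ θ)
    (hins : M.InsertionRate W κ E₀ δ' θ) (hR : ReadsChannel M (evalChannel F₀ ν w bg) out W)
    (hw : ∀ k s y, ∀ X ∈ F₀ k s y, Integrable (w k s y X) (ν k s y X)) (hF : ∀ k s y, ∀ X ∈ F₀ k s y, C.scale X ≤ k)
    (hmass : ∀ (k j : ℕ) (s : ℕ → ℝ) (y : ι),
      ∑ X ∈ (F₀ k s y).filter (fun X => C.scale X = j), Real.exp (-(κ * C.d X)) * ∫ ω', |w k s y X ω'| ∂(ν k s y X) ≤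
        wt k y * τ k j)
    (hwt0 : ∀ k i, 0 ≤ wt k (out i)) (hwt : ∀ k i, wt k (out i) ≤ M.rHist (k + 1) * F.wt i)
    (hτ : ∀ k j, j ≤ k → τ k j ≤ c * ω ^ (k - j)) (hG : 0 ≤ G) (hδ : 0 ≤ δ + δ') (hθ : 0 ≤ θ) (hθθ' : θ ≤ θ')
    (hθ'1 : θ' ≤ 1) (hc : 0 ≤ c) (hω : 0 < ω) (hρ₀ : ρ₀ < 1) (hnear : (δ + δ') * θ ^ k₀ + c * (EA₀ + E₀) / (1 - ω) ≤ ρ₀)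
    (hB : 0 ≤ B) (hfirst : ∀ k < k₀, EA₀ + E₀ ≤ B * θ ^ k) (hsmall : ω + G / (1 - ρ₀) * c < θ') :
    NE5 EA EB W κ θ' ((G / (1 - ρ₀) * (δ + δ') + B) * (θ' - ω) / (θ' - (ω + G / (1 - ρ₀) * c))) :=
  M.ne5_at_of_stepModel_lip_nat hrA hrB hbase (M.dataLipschitz_of_fibreEnvelopes hopF hhistF hρ₀) hdA hdB hop hins
    (insertionDampedNat_of_readsEvalChannel hR hw hF hmass hwt0 hwt hτ hc hω.le) (div_nonneg hG (by linarith)) hδ hθ hθθ' hθ'1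
    hc hω hnear hB hfirst hsmall

end EndEval

section EndPiece

variable {α β γ : Type} {P : PieceData C Bg ι α β γ}

/-- [folklore] **NE5 FOR A STEP MODEL READING THE GAIN-PARAMETRIC PIECE FORM** (general profile `cQ`, `ω > 0`; print: `cQ = (6L)⁴`,
`ω = L^{−α}`): C1 with W2 as the fibre envelopes and `hdamp` DISCHARGED by `insertionDampedNat_of_readsPieceChannelG` — the reading,
`SrcScale`, `PieceBoundG` (row NE9's displayed binder), `LevelCountsG … (agePow ω)` (row NE9's kernel currency of record), the signs and the
weight dictionary; NO homogeneity, NO reference level; the conclusion is E1′'s constant. -/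
theorem ne5_at_of_stepModel_fibre_pieceChannelG_nat {EA : Functional C C.BgA} {EB : Functional C C.BgB}
    {κ κ₁ d0 O1 cQ ω G EA₀ E₀ δ δ' θ θ' ρ₀ B : ℝ} {k₀ : ℕ} {Kp : ℕ → ι → ℝ} {gain : ℕ → ℕ → ℝ}
    (hrA : M.RepresentsA EA W) (hrB : M.RepresentsB EB W) (hbase : M.InBase EB W) (hopF : M.OpFibreEnvelope W κ G)
    (hhistF : M.HistFibreEnvelope W κ G) (hdA : DecayBound EA W EA₀ κ) (hdB : DecayBound EB W E₀ κ) (hop : M.OperatorRate W δ θ)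
    (hins : M.InsertionRate W κ E₀ δ' θ) (hR : ReadsChannel M (pieceChannel P) out W) (hsrc : SrcScale P)
    (hPiece : PieceBoundG P κ κ₁ d0 Kp gain) (hLev : LevelCountsG P κ κ₁ O1 cQ gain (agePow ω)) (hKp : ∀ k y, 0 ≤ Kp k y)
    (hO1 : 0 ≤ O1) (hgain : ∀ k j, 0 ≤ gain k j) (hwt : ∀ k i, weightOf P κ₁ d0 O1 Kp k (out i) ≤ M.rHist (k + 1) * F.wt i)
    (hG : 0 ≤ G) (hδ : 0 ≤ δ + δ') (hθ : 0 ≤ θ) (hθθ' : θ ≤ θ') (hθ'1 : θ' ≤ 1) (hcQ : 0 ≤ cQ) (hω : 0 < ω) (hρ₀ : ρ₀ < 1)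
    (hnear : (δ + δ') * θ ^ k₀ + cQ * (EA₀ + E₀) / (1 - ω) ≤ ρ₀) (hB : 0 ≤ B) (hfirst : ∀ k < k₀, EA₀ + E₀ ≤ B * θ ^ k)
    (hsmall : ω + G / (1 - ρ₀) * cQ < θ') :
    NE5 EA EB W κ θ' ((G / (1 - ρ₀) * (δ + δ') + B) * (θ' - ω) / (θ' - (ω + G / (1 - ρ₀) * cQ))) :=
  M.ne5_at_of_stepModel_lip_nat hrA hrB hbase (M.dataLipschitz_of_fibreEnvelopes hopF hhistF hρ₀) hdA hdB hop hins
    (insertionDampedNat_of_readsPieceChannelG hR hsrc hPiece hLev hKp hO1 hgain hcQ hω.le hwt) (div_nonneg hG (by linarith)) hδ hθ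
    hθθ' hθ'1 hcQ hω hnear hB hfirst hsmall

/-- [folklore] **NE5 AT THE PRINTED-COUNT LETTERS `c = (6L)⁴`, `ω = L⁻¹` FOR A STEP MODEL READING THE ℓ⁵-PIECE FORM**: the owner's C1 face
`OutputRateCount124.ne5_at_of_stepModel_lip_count124_nat` with W2 as the fibre envelopes (`Λ = G∕(1 − ρ₀)`), `hdamp` DISCHARGED by
`insertionDampedNat_of_readsPieceChannel` (the reading + `SrcScale` + `PieceBound` + `LevelCounts` + signs + weight dictionary; NO
homogeneity), and the smallness in the `G`-form `G < (θ′ − L⁻¹)(1 − ρ₀)∕(6L)⁴` (owner R30 (iii); converted by `smallnessG_count124_iff` ∕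
`smallness_count124_iff`); conclusion = E1′-at-the-letters' constant, character for character. -/
theorem ne5_at_of_stepModel_fibre_pieceChannel_nat {EA : Functional C C.BgA} {EB : Functional C C.BgB}
    {L κ κ₁ d0 O1 G EA₀ E₀ δ δ' θ θ' ρ₀ B : ℝ} {k₀ : ℕ} {Kp : ℕ → ι → ℝ} (hL : 1 < L)
    (hrA : M.RepresentsA EA W) (hrB : M.RepresentsB EB W) (hbase : M.InBase EB W) (hopF : M.OpFibreEnvelope W κ G)
    (hhistF : M.HistFibreEnvelope W κ G) (hdA : DecayBound EA W EA₀ κ) (hdB : DecayBound EB W E₀ κ) (hop : M.OperatorRate W δ θ)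
    (hins : M.InsertionRate W κ E₀ δ' θ) (hR : ReadsChannel M (pieceChannel P) out W) (hsrc : SrcScale P)
    (hPiece : PieceBound P κ κ₁ d0 Kp (ellPrinted L)) (hLev : LevelCounts P κ κ₁ O1 L (ellPrinted L))
    (hKp : ∀ k y, 0 ≤ Kp k y) (hO1 : 0 ≤ O1) (hwt : ∀ k i, weightOf P κ₁ d0 O1 Kp k (out i) ≤ M.rHist (k + 1) * F.wt i)
    (hG : 0 ≤ G) (hδ : 0 ≤ δ + δ') (hθ : 0 ≤ θ) (hθθ' : θ ≤ θ') (hθ'1 : θ' ≤ 1) (hρ₀ : ρ₀ < 1)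
    (hnear : (δ + δ') * θ ^ k₀ + (6 * L) ^ 4 * (EA₀ + E₀) / (1 - L⁻¹) ≤ ρ₀) (hB : 0 ≤ B)
    (hfirst : ∀ k < k₀, EA₀ + E₀ ≤ B * θ ^ k) (hsmall : G < (θ' - L⁻¹) * (1 - ρ₀) / (6 * L) ^ 4) :
    NE5 EA EB W κ θ'
      ((G / (1 - ρ₀) * (δ + δ') + B) * (θ' - L⁻¹) / (θ' - (L⁻¹ + G / (1 - ρ₀) * (6 * L) ^ 4))) :=
  have hL0 : 0 < L := by linarith
  OutputRateCount124.ne5_at_of_stepModel_lip_count124_nat M hL hrA hrB hbase (M.dataLipschitz_of_fibreEnvelopes hopF hhistF hρ₀)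
    hdA hdB hop hins (insertionDampedNat_of_readsPieceChannel hR hsrc hL hPiece hLev hKp hO1 hwt) (div_nonneg hG (by linarith)) hδ
    hθ hθθ' hθ'1 hnear hB hfirst ((smallness_count124_iff hL0).1 ((smallnessG_count124_iff hL0 hρ₀).2 hsmall))

end EndPiece

end Summit.QuantumFields.BalabanUV.T4Continuum.InsertionChannelEnd

end
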